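/-
Copyright (c) 2026 H21 harness. All rights reserved.
Released under Apache 2.0 license as described in the file LICENSE.
-/
import Summits.ResolutionOfSingularities.ResolutionOfSingularities.Theorems.FrobeniusClosingSteerHevLeafWords
import Summits.ResolutionOfSingularities.ResolutionOfSingularities.Theorems.FrobeniusClosingSteerOrderInductionWords
import HarnessLib

/-!
# FrobeniusClosingSteerHevLeafSpineInd — the hEv leaf spine WITH THE ORDER-INDUCTION BINDER (W4.1, binder `hEvᴵ` of the r46 T-line)

OURS (campaign `res-hironaka`, rung L ★L-G4, slot W4.1; pen res-L0-w41-strat-2 g3 = the order-induction pen of RULINGS 166a/170b/177b, OFFERED to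
res-L0-w41-idea-2 g13 = the hEv-leaf pen of RULING 161c, who may adopt or re-cut it). Replaces the role of NOTHING in the manuscript under review
[claim: Hironaka2017, status: under-review]; these are the campaignʼs OWN words; nothing is attributed to its author; nothing is a Literature fact;
AI review is weaker than expert review.

WHY. Since r46 (`Steer` skeleton of record, T-line `eternalSteeredRunTwo_of_slate17`) the hEv binder is the INDUCTIVE word
`StrippingTailSwitchingEvenConclIndTwoN` = hEv + one last hypothesis `OrderInduction.ConclBelowDatum p k K O A₀ t` («`Concl` for every core datum over
the same `O` of strictly smaller first cleaned order», tree file `…Theorems.FrobeniusClosingSteerOrderInductionWords`), because the [hEv-∞] leaf (idea-2ʼs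
divisor shadow, CARRIER-LEMMA §N/§R) concludes by handing a LOWER-ORDER datum to that hypothesis. The words file `…HevLeafWords` states the PLAIN words;
this file threads the binder through the leafʼs spine, pointwise, exactly as the skeleton threads it through the hEv → T glue:

* `StrippingTailSwitchingEvenInfConclIndTwoN` = [hEv-∞] `StrippingTailSwitchingEvenInfConclTwoN` VERBATIM + the binder (the word the [hEv-∞] leaf should
  now prove: its proof may use `hbelow` on the shadow datum);
* `StrippingTailSwitchingEvenConclIndTwoN` = the restated hEv word VERBATIM + the binder (the skeletonʼs hEvᴵ, restated here so the spine concludes it BY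
  NAME; strat-2ʼs r47 δ-bridge identifies the two by η-expansion);
* `_of_plain` lifts (the plain words imply the inductive ones), the spine `strippingTailSwitchingEvenConclIndTwoN_of_piecesI : [T-run] → [B-run] → [L-run]
  → [hEv-∞]ᴵ → hEvᴵ` (idea-2ʼs `…_of_pieces` with `hbelow` threaded) and the leaf modulo seams `hEvI_of_LBKE_of_seamsI`.

Pure logic; sorry-free; no new mathematics. Tags: «(folklore)» on `def … : Prop` words, «[folklore]» on proved glue (gate `relocate` lint, stub-4 16:03Z). [T-run], [B-run], [L-run], the seams, [L], [B], [K♭-E] keep their PLAIN statements (they do not consume the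
induction hypothesis).
-/

set_option linter.dupNamespace false

open IsLocalRing
open Literature.AlgebraicGeometry.Resolution
open Summit.ResolutionOfSingularities.ResolutionOfSingularities.Theorems.SwitchingDichotomy.Words
open Summit.ResolutionOfSingularities.ResolutionOfSingularities.Theorems.SteerRankThinness (Concl HasProperCoarsening)
open Summit.ResolutionOfSingularities.ResolutionOfSingularities.Theorems.SwitchingDichotomy.ArithReduction

namespace Summit.ResolutionOfSingularities.ResolutionOfSingularities.Theorems.SwitchingDichotomy.HevLeaf

section RunInd

variable {K : Type} [Field K]

/-- **[hEv-∞]ᴵ `StrippingTailSwitchingEvenInfConclIndTwoN`** = `StrippingTailSwitchingEvenInfConclTwoN` (…HevLeafWords) VERBATIM + the LAST hypothesis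
`OrderInduction.ConclBelowDatum p k K O A₀ t` (strong induction on the first cleaned order of the core datum, run at the T root; RULINGS 166a/177b).
This is the word the [hEv-∞] leaf proves: at a late window member the divisor shadow is a core datum over the same `O` of first cleaned order
`≤ 2e − 4`, handed to `hbelow` (modulo the slack word EFO₃ of `…OrderInductionWords` §σ2.34). OURS. (folklore) -/
def StrippingTailSwitchingEvenInfConclIndTwoN : Prop :=
  ∀ p : ℕ, p = 2 →
    ∀ (k K : Type) [Field k] [CharP k p] [PerfectField k] [Field K] [Algebra k K]
    (O : ValuationSubring K) (A₀ : Subalgebra k K) (h₀ : A₀.toSubring ≤ O.toSubring) (t : K),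
    CoreDatum p 4 k K O A₀ h₀ t → ¬ HasProperCoarsening O →
    ∀ (R : ℕ → Subring K) (P : (i : ℕ) → Ideal (R i)) (s : ℕ → K),
      R 0 = locAtCentre A₀.toSubring O → NormalAt O (R 0) p t → IsSteeredRun O R P t p s →
      (¬ ∃ i₀ c : ℕ, 1 ≤ c ∧ IsDominantTail R P i₀ c) →
      (∃ i₀ : ℕ, ∀ i, i₀ ≤ i → IsHighOrderAt R s p i) →
      ¬ HeightTwoStepsInfinite R P → {j | IsPosStep R P j}.Infinite →
      (∀ i₀ : ℕ, ∃ i, i₀ ≤ i ∧ IsPointStep R P i ∧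
        ∀ hs : s i ^ p ∈ R i, ¬ HasIsolatedSingularity (RadicandRing (R i) p ⟨s i ^ p, hs⟩)) →
      (¬ ∃ i₀ : ℕ, ∃ x : K, x ≠ 0 ∧ x ∈ O ∧ O.valuation x < 1 ∧
        ∀ i, i₀ ≤ i → ∀ y ∈ R i, O.valuation y < 1 → ∃ j, i < j ∧ y / x ∈ R j) →
      (∃ i₀ : ℕ, ∀ i, i₀ ≤ i → ¬ OddCleanedPointStepAt R P s p i) →
      (∃ i₀ e : ℕ, 2 ≤ e ∧ ∀ i, i₀ ≤ i → IsPointStep R P i → BinaryResiduePointStepAt R P s p (2 * e) i) →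
      (∀ i₀ : ℕ, ∃ i i' : ℕ, i₀ ≤ i ∧ IsSatellitePair R P i i') →
      (∃ i₀ : ℕ, ∀ i i' : ℕ, i₀ ≤ i → IsSatellitePair R P i i' → ¬ NoSingularSurfaceAt R s p i') →
      OrderInduction.ConclBelowDatum p k K O A₀ t →
      Concl O A₀ t

/-- **hEvᴵ `StrippingTailSwitchingEvenConclIndTwoN`** = the restated hEv word `StrippingTailSwitchingEvenConclTwoN` (…HevLeafWords, r42 text) VERBATIM +
the LAST hypothesis `OrderInduction.ConclBelowDatum p k K O A₀ t` — the text of the skeletonʼs hEvᴵ binder (r46 `Steer` l.5222-area twin), restated so that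
the spine below concludes it BY NAME. OURS. (folklore) -/
def StrippingTailSwitchingEvenConclIndTwoN : Prop :=
  ∀ p : ℕ, p = 2 →
    ∀ (k K : Type) [Field k] [CharP k p] [PerfectField k] [Field K] [Algebra k K]
    (O : ValuationSubring K) (A₀ : Subalgebra k K) (h₀ : A₀.toSubring ≤ O.toSubring) (t : K),
    CoreDatum p 4 k K O A₀ h₀ t → ¬ HasProperCoarsening O →
    ∀ (R : ℕ → Subring K) (P : (i : ℕ) → Ideal (R i)) (s : ℕ → K),
      R 0 = locAtCentre A₀.toSubring O → NormalAt O (R 0) p t → IsSteeredRun O R P t p s →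
      (¬ ∃ i₀ c : ℕ, 1 ≤ c ∧ IsDominantTail R P i₀ c) →
      (∃ i₀ : ℕ, ∀ i, i₀ ≤ i → IsHighOrderAt R s p i) →
      ¬ HeightTwoStepsInfinite R P → {j | IsPosStep R P j}.Infinite →
      (∀ i₀ : ℕ, ∃ i, i₀ ≤ i ∧ IsPointStep R P i ∧
        ∀ hs : s i ^ p ∈ R i, ¬ HasIsolatedSingularity (RadicandRing (R i) p ⟨s i ^ p, hs⟩)) →
      (¬ ∃ i₀ : ℕ, ∃ x : K, x ≠ 0 ∧ x ∈ O ∧ O.valuation x < 1 ∧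
        ∀ i, i₀ ≤ i → ∀ y ∈ R i, O.valuation y < 1 → ∃ j, i < j ∧ y / x ∈ R j) →
      (∃ i₀ : ℕ, ∀ i, i₀ ≤ i → ¬ OddCleanedPointStepAt R P s p i) →
      OrderInduction.ConclBelowDatum p k K O A₀ t →
      Concl O A₀ t

/-- Lift: the plain [hEv-∞] word implies the inductive one (ignore the hypothesis). Pure logic. OURS. [folklore] -/
theorem strippingTailSwitchingEvenInfConclIndTwoN_of_plain (h : (StrippingTailSwitchingEvenInfConclTwoN : Prop)) :
    StrippingTailSwitchingEvenInfConclIndTwoN :=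
  fun p hp2 k K _ _ _ _ _ O A₀ h₀ t core hrk R P s hR0 hN hrun hnd hhigh h2 hinf hwild hsw hev hbin hsat hsing _ =>
    h p hp2 k K O A₀ h₀ t core hrk R P s hR0 hN hrun hnd hhigh h2 hinf hwild hsw hev hbin hsat hsing

/-- Lift: the plain hEv word implies the inductive one. Pure logic. OURS. [folklore] -/
theorem strippingTailSwitchingEvenConclIndTwoN_of_plain (h : (StrippingTailSwitchingEvenConclTwoN : Prop)) :
    StrippingTailSwitchingEvenConclIndTwoN :=
  fun p hp2 k K _ _ _ _ _ O A₀ h₀ t core hrk R P s hR0 hN hrun hnd hhigh h2 hinf hwild hsw hev _ =>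
    h p hp2 k K O A₀ h₀ t core hrk R P s hR0 hN hrun hnd hhigh h2 hinf hwild hsw hev

/-- **THE SPINE WITH THE BINDER (PROVED, pure logic): hEvᴵ ⟸ [T-run] ∧ [B-run] ∧ [L-run] ∧ [hEv-∞]ᴵ** — idea-2ʼs
`strippingTailSwitchingEvenConclTwoN_of_pieces` with `hbelow` threaded to the [hEv-∞] slot. OURS. [folklore] -/
theorem strippingTailSwitchingEvenConclIndTwoN_of_piecesI
    (hT : StrippingTailSwitchingEvenTransversalConclTwoN)
    (hB : StrippingTailSwitchingEvenBinaryTwoN)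
    (hL : StrippingTailSwitchingEvenSatelliteSurfaceTwoN)
    (hInf : StrippingTailSwitchingEvenInfConclIndTwoN) :
    StrippingTailSwitchingEvenConclIndTwoN := by
  intro p hp2 k K _ _ _ _ _ O A₀ h₀ t core hrk R P s hR0 hN hrun hnd hhigh h2 hinf hwild hsw hev hbelow
  by_cases hsat : ∀ i₀ : ℕ, ∃ i i' : ℕ, i₀ ≤ i ∧ IsSatellitePair R P i i'
  · exact hInf p hp2 k K O A₀ h₀ t core hrk R P s hR0 hN hrun hnd hhigh h2 hinf hwild hsw hev
      (hB p hp2 k K O A₀ h₀ t core hrk R P s hR0 hN hrun hnd hhigh h2 hinf hwild hsw hev hsat) hsat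
      (hL p hp2 k K O A₀ h₀ t core hrk R P s hR0 hN hrun hnd hhigh h2 hinf hwild hsw hev) hbelow
  · push Not at hsat
    exact hT p hp2 k K O A₀ h₀ t core hrk R P s hR0 hN hrun hnd hhigh h2 hinf hwild hsw hev hsat

end RunInd

section SeamsInd

/-- **THE LEAF MODULO SEAMS, WITH THE BINDER `hEvI_of_LBKE_of_seamsI`** : [T-run] → `BinaryRunSeam` → `SatelliteSurfaceRunSeam` → [L] → [B] → [K♭-E] →
[hEv-∞]ᴵ → hEvᴵ (idea-2ʼs `hEv_of_LBKE_of_seams`, inductive form; the shape of strat-2ʼs r47 feeder `eternalSteeredRunTwo_of_slate17_hev`).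
OURS. [folklore] -/
theorem hEvI_of_LBKE_of_seamsI (hT : (StrippingTailSwitchingEvenTransversalConclTwoN : Prop)) (hBs : BinaryRunSeam)
    (hLs : SatelliteSurfaceRunSeam) (hL : LWords) (hB : BWords) (hKE : StrippingTailSwitchingEvenWindowsTwoN)
    (hInf : (StrippingTailSwitchingEvenInfConclIndTwoN : Prop)) : (StrippingTailSwitchingEvenConclIndTwoN : Prop) :=
  strippingTailSwitchingEvenConclIndTwoN_of_piecesI hT (hBs hKE hB) (hLs hKE hL hB.2.2) hInf

end SeamsInd

end Summit.ResolutionOfSingularities.ResolutionOfSingularities.Theorems.SwitchingDichotomy.HevLeaf
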